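import Summits.ResolutionOfSingularities.ResolutionOfSingularities.Theorems.FrobeniusLadderFInjectiveMacaulayficationTCaFloorOneFull
import Summits.ResolutionOfSingularities.ResolutionOfSingularities.Theorems.FrobeniusLadderFInjectiveMacaulayficationP3d4z4557PointFloor
import Summits.ResolutionOfSingularities.ResolutionOfSingularities.Theorems.FrobeniusLadderFInjectiveMacaulayficationFHalfRowOfProductCentre
import HarnessLib

/-!
# BED TCa (`z⁴ + x²y² + x⁵ + y⁵ + u⁵ + t⁵`, char 2): the «FLOOR-1-FULL ROW» — specimen, point-blow-up charts, ★★ `Bl_𝔪 X` FULL at every point, legal ∧ FULL at the germ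
# (crux `FInjectiveMacaulayfication` stmt-ResolutionOfSingularities-15315, chain w45a; res-L1-w45a-plan-1 RULINGS R21.17 (3)(a) «TCa ROW — file it HONESTLY as a FLOOR-1-FULL row»,
# R21.18 (1); seat res-L1-w45a-stub-1 g12 (bus 19:41Z TAKING); F-side certificates = res-L1-w45a-idea-1 g26's (✓ p661452 port); specimen pattern = res-L1-w45a-stub-3's
# ✓ p653663/p653916 `P3d4z4557Specimen/PointFloor`)

[OURS · L1 W4.5a] Support file (`--supports stmt-ResolutionOfSingularities-15315 --as helper`); def-free; UNCONDITIONAL; no named fact; NOT a statement of any manuscript.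
HONEST LABEL: species-3 bed (tangent cone `(z²+xy)²`, intrinsically Tjurina-degenerate, `f ∈ 𝔪^{[2]}` so `X` is NOT F-pure at `v`), whose point floor is legal AND
ALREADY FULL — the F-half instance at the point floor holds with the floor itself (recurrence depth 0); nothing of the crux is proved. AI-written (AI review weaker than expert review).

`X 0 = x, X 1 = y, X 2 = u, X 3 = t, X 4 = z`, `f = z⁴ + x²y² + x⁵ + y⁵ + u⁵ + t⁵`, `char k = 2`, ANY field `k`.
* §1 specimen: `prime_f` (`T⁴ + C(c)` Eisenstein-type at `(x,y,u,t) = (1,0,0,1)`: `c = 2 = 0`, `∂_t c = 5t⁴ = 1`), `constantCoeff_f`, `f_not_mem_span_X`, `mk_X_ne_zero`, `pderiv_f`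
  (`x⁴, y⁴, u⁴, t⁴, 0`), ★ `regular_off_vertex`, `vertex_not_mem_regularLocus`, `regular_of_ne_vertex`;
* §2 charts (`μ = 4`): `theta`, `g_not_mem_span_X`;
* §3 ★★ `tca_pointBlowup_fullCl` — `Bl_𝔪 X = affineBlowup 𝔪` is FULL AT EVERY POINT (`GermOfGlobalBlowup.hypersurfacePointBlowup_fullCl` with `hpts :=` ✓ p661452
  `TCaFloorOneFull.tca_clause_every_chart_every_point`), ★★ `tca_fInjectivizationGermAt` (`FInjectivizationGermAt 2 v`: the F-half's ∃-conclusion at the germ, witnessed by the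
  point floor itself);
* §4 «legal ∧ FULL»: `pointFloor_tca_input_legal` (✓ p651649) and ★ `pointFloor_tca_full` (EVERY blowing up of `Spec 𝒪_{X,v}` along `𝔪̃` is FULL at every stalk).
[cite: Fedder1983, Prop. 1.7 and Thm. 1.12] [cite: Hartshorne1977, I Thm. 5.1] [cite: GortzWedhorn2020, Prop. 13.91] [cite: StacksProject, Tag 0804]
-/

-- single-problem summit: the doubled namespace component is forced
set_option linter.dupNamespace false

noncomputable section

open AlgebraicGeometry CategoryTheory CategoryTheory.Limits Literature.AlgebraicGeometry.Resolution TopologicalSpace IsLocalRing MvPolynomial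

namespace Summit.ResolutionOfSingularities.ResolutionOfSingularities.Theorems.FInjectiveMacaulayfication.TCaFloorOneRow

open Summit.ResolutionOfSingularities.ResolutionOfSingularities.Theorems.FInjectiveMacaulayfication
open SliceableCentre GermForm GermOfGlobalBlowup

variable (k : Type) [Field k]

/-! ## §1 The specimen -/

/-- `f(0) = 0`. [plumbing] -/
theorem constantCoeff_f (f : MvPolynomial (Fin 5) k) (hf : f = X 4 ^ 4 + X 0 ^ 2 * X 1 ^ 2 + X 0 ^ 5 + X 1 ^ 5 + X 2 ^ 5 + X 3 ^ 5) :
    constantCoeff f = 0 := by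
  rw [hf]; simp [constantCoeff_X]

/-- ★ **`f` is PRIME** (characteristic 2, any field): `T⁴ + C(c)`, `c = x²y² + x⁵ + y⁵ + u⁵ + t⁵`, Eisenstein-type at `(1,0,0,1)` (`c = 2 = 0`, `∂_t c = 5t⁴ = 1`).
[folklore; res-L1-w45a-stub-3's `P3d4z4557Specimen.prime_f` pattern] -/
theorem prime_f [CharP k 2] (f : MvPolynomial (Fin 5) k) (hf : f = X 4 ^ 4 + X 0 ^ 2 * X 1 ^ 2 + X 0 ^ 5 + X 1 ^ 5 + X 2 ^ 5 + X 3 ^ 5) : Prime f := by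
  set e : MvPolynomial (Fin 5) k ≃+* Polynomial (MvPolynomial (Fin 4) k) :=
    ((renameEquiv k (_root_.finRotate 5)).trans (finSuccEquiv k 4)).toRingEquiv with he_def
  have hrot4 : (_root_.finRotate 5) (4 : Fin 5) = 0 := by decide
  have hrot : ∀ j : Fin 4, (_root_.finRotate 5) (Fin.castSucc j) = j.succ := by decide
  have he4 : e (X 4) = Polynomial.X := by
    show finSuccEquiv k 4 (rename _ (X 4)) = _
    rw [rename_X, hrot4]; exact finSuccEquiv_X_zero
  have hej : ∀ j : Fin 4, e (X (Fin.castSucc j)) = Polynomial.C (X j) := fun j => by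
    show finSuccEquiv k 4 (rename _ (X (Fin.castSucc j))) = _
    rw [rename_X, hrot j]; exact finSuccEquiv_X_succ (j := j)
  set b : MvPolynomial (Fin 4) k := 0 with hb
  set c : MvPolynomial (Fin 4) k := X 0 ^ 2 * X 1 ^ 2 + X 0 ^ 5 + X 1 ^ 5 + X 2 ^ 5 + X 3 ^ 5 with hc
  have hef : e f = Polynomial.X ^ 4 + Polynomial.C b * Polynomial.X + Polynomial.C c := by
    rw [hf, map_add, map_add, map_add, map_add, map_add, map_pow, he4, map_mul, map_pow, map_pow, map_pow, map_pow, map_pow, map_pow,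
      show (0 : Fin 5) = Fin.castSucc (0 : Fin 4) from rfl, show (1 : Fin 5) = Fin.castSucc (1 : Fin 4) from rfl,
      show (2 : Fin 5) = Fin.castSucc (2 : Fin 4) from rfl, show (3 : Fin 5) = Fin.castSucc (3 : Fin 4) from rfl, hej, hej, hej, hej, hb, hc]
    simp only [map_add, map_pow, map_mul, map_zero, zero_mul, add_zero]
    ring
  set a : Fin 4 → k := ![1, 0, 0, 1] with ha
  have h2 : (2 : k) = 0 := by simpa using CharP.cast_eq_zero k 2
  have h5 : (5 : k) = 1 := by
    calc (5 : k) = 2 * 2 + 1 := by norm_num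
      _ = 1 := by rw [h2]; ring
  have hba : MvPolynomial.eval a b = 0 := by rw [hb, map_zero]
  have hca : MvPolynomial.eval a c = 0 := by
    rw [hc]
    simp only [map_add, map_mul, map_pow, eval_X, ha, Matrix.cons_val_zero, Matrix.cons_val_one]
    simp only [Matrix.cons_val, one_pow, zero_pow (by norm_num : (5 : ℕ) ≠ 0), zero_pow (by norm_num : (2 : ℕ) ≠ 0), mul_zero, add_zero, zero_add]
    rw [show (1 : k) + 1 = 2 by norm_num, h2]
  have hder : MvPolynomial.eval a (pderiv 3 c) ≠ 0 := by
    have e1 : pderiv 3 c = 5 * X 3 ^ 4 := by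
      rw [hc, map_add, map_add, map_add, map_add, Derivation.leibniz, pderiv_pow, pderiv_pow, pderiv_X_of_ne (show (0 : Fin 4) ≠ 3 by decide),
        pderiv_X_of_ne (show (1 : Fin 4) ≠ 3 by decide), pderiv_pow, pderiv_X_of_ne (show (0 : Fin 4) ≠ 3 by decide), pderiv_pow,
        pderiv_X_of_ne (show (1 : Fin 4) ≠ 3 by decide), pderiv_pow, pderiv_X_of_ne (show (2 : Fin 4) ≠ 3 by decide), pderiv_pow, pderiv_X_self]
      simp only [mul_zero, smul_zero, add_zero, zero_add, mul_one]
      push_cast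
      ring
    rw [e1, map_mul, map_pow, eval_X, ha]
    simp only [Matrix.cons_val, one_pow, mul_one]
    rw [map_ofNat, h5]
    exact one_ne_zero
  have hirr : Irreducible (e f) := by
    rw [hef]
    exact Literature.AlgebraicGeometry.Motives.SmoothHypersurface.irreducible_X_pow_add_C_mul_X_add_C (d := 4) (by norm_num) b c a hba hca 3 hder
  exact (MulEquiv.prime_iff e).mp hirr.prime

/-- `(f)` is prime. [folklore] -/
theorem isPrime_span_f [CharP k 2] (f : MvPolynomial (Fin 5) k) (hf : f = X 4 ^ 4 + X 0 ^ 2 * X 1 ^ 2 + X 0 ^ 5 + X 1 ^ 5 + X 2 ^ 5 + X 3 ^ 5) :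
    (Ideal.span {f}).IsPrime :=
  (Ideal.span_singleton_prime (prime_f k f hf).ne_zero).mpr (prime_f k f hf)

/-- `f ∉ (X i)` for every `i` (`f(e_x) = 1`, `f(e_z) = 1`). [certificate] -/
theorem f_not_mem_span_X (f : MvPolynomial (Fin 5) k) (hf : f = X 4 ^ 4 + X 0 ^ 2 * X 1 ^ 2 + X 0 ^ 5 + X 1 ^ 5 + X 2 ^ 5 + X 3 ^ 5) :
    ∀ i : Fin 5, f ∉ Ideal.span {(X i : MvPolynomial (Fin 5) k)} := by
  intro i h
  rw [Ideal.mem_span_singleton] at h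
  obtain ⟨c, hc⟩ := h
  by_cases hi : i = 4
  · subst hi
    have := congrArg (MvPolynomial.eval (Pi.single 0 1 : Fin 5 → k)) hc
    rw [hf] at this
    simp at this
  · have := congrArg (MvPolynomial.eval (Pi.single 4 1 : Fin 5 → k)) hc
    rw [hf] at this
    have h1 : (Pi.single 4 1 : Fin 5 → k) i = 0 := by rw [Pi.single_apply, if_neg hi]
    simp [h1] at this

/-- No variable vanishes in `k[X]/(f)` (`hXne`). [folklore] -/
theorem mk_X_ne_zero [CharP k 2] (f : MvPolynomial (Fin 5) k) (hf : f = X 4 ^ 4 + X 0 ^ 2 * X 1 ^ 2 + X 0 ^ 5 + X 1 ^ 5 + X 2 ^ 5 + X 3 ^ 5) (i : Fin 5) :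
    Ideal.Quotient.mk (Ideal.span {f}) (X i) ≠ 0 := fun h0 =>
  PrimeTransfer.X_not_mem_span_of_isPrime (isPrime_span_f k f hf) (f_not_mem_span_X k f hf i) (Ideal.Quotient.eq_zero_iff_mem.mp h0)

/-- The partials of `f` in characteristic 2: `∂_x f = x⁴`, `∂_y f = y⁴`, `∂_u f = u⁴`, `∂_t f = t⁴`, `∂_z f = 0`. [certificate] -/
theorem pderiv_f [CharP k 2] (f : MvPolynomial (Fin 5) k) (hf : f = X 4 ^ 4 + X 0 ^ 2 * X 1 ^ 2 + X 0 ^ 5 + X 1 ^ 5 + X 2 ^ 5 + X 3 ^ 5) :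
    (∀ j : Fin 5, j ≠ 4 → pderiv j f = X j ^ 4) ∧ pderiv 4 f = 0 := by
  obtain ⟨h2, h5⟩ := TCaFloorOneFull.two_five k
  have h4 : (4 : MvPolynomial (Fin 5) k) = 0 := by
    calc (4 : MvPolynomial (Fin 5) k) = 2 * 2 := by norm_num
      _ = 0 := by rw [h2]; ring
  subst hf
  refine ⟨fun j hj => ?_, ?_⟩
  · have hj' : j = 0 ∨ j = 1 ∨ j = 2 ∨ j = 3 := by fin_cases j <;> simp_all
    rcases hj' with rfl | rfl | rfl | rfl <;>
    · simp (disch := decide) only [map_add, Derivation.leibniz, Derivation.leibniz_pow, pderiv_X_self, pderiv_X_of_ne, smul_eq_mul, mul_zero, mul_one,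
        add_zero, zero_add, nsmul_eq_mul, smul_zero]
      push_cast
      simp only [h2, h5, zero_mul, mul_zero, zero_add, one_mul]
  · simp (disch := decide) only [map_add, Derivation.leibniz, Derivation.leibniz_pow, pderiv_X_self, pderiv_X_of_ne, smul_eq_mul, mul_zero, mul_one,
      add_zero, nsmul_eq_mul, smul_zero]
    push_cast
    simp only [h4, zero_mul]

/-- ★ **`X` IS REGULAR OFF THE ORIGIN** (localization form): at a prime `P ⊉ 𝔪` some variable `x_j`, `j ≠ z`, misses `P` (`z⁴ = f − …`), and then `∂_j f = x_j⁴ ∉ P`.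
[cite: Hartshorne1977, I Thm. 5.1] -/
theorem regular_off_vertex [CharP k 2] (f : MvPolynomial (Fin 5) k) (hf : f = X 4 ^ 4 + X 0 ^ 2 * X 1 ^ 2 + X 0 ^ 5 + X 1 ^ 5 + X 2 ^ 5 + X 3 ^ 5)
    (P : Ideal (MvPolynomial (Fin 5) k ⧸ Ideal.span {f})) [P.IsPrime]
    (hP : ¬ Ideal.span (Set.range fun j : Fin 5 => Ideal.Quotient.mk (Ideal.span {f}) (X j)) ≤ P) :
    IsRegularLocalRing (Localization.AtPrime P) := by
  obtain ⟨hd, -⟩ := pderiv_f k f hf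
  have hP' : (P.comap (Ideal.Quotient.mk (Ideal.span {f}))).IsPrime := Ideal.comap_isPrime _ _
  set P' := P.comap (Ideal.Quotient.mk (Ideal.span {f})) with hP'def
  have hex : ∃ j : Fin 5, j ≠ 4 ∧ (X j : MvPolynomial (Fin 5) k) ∉ P' := by
    by_contra hall
    push Not at hall
    apply hP
    rw [Ideal.span_le]
    rintro _ ⟨j, rfl⟩
    change X j ∈ P'
    by_cases hj : j = 4
    · subst hj
      have hfP : f ∈ P' := FermatCubicConeChar2.self_mem_comap f P
      have hx : (X 0 : MvPolynomial (Fin 5) k) ∈ P' := hall 0 (by decide)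
      have hy : (X 1 : MvPolynomial (Fin 5) k) ∈ P' := hall 1 (by decide)
      have hu : (X 2 : MvPolynomial (Fin 5) k) ∈ P' := hall 2 (by decide)
      have ht : (X 3 : MvPolynomial (Fin 5) k) ∈ P' := hall 3 (by decide)
      have hz4 : (X 4 : MvPolynomial (Fin 5) k) ^ 4 ∈ P' := by
        have e : (X 4 : MvPolynomial (Fin 5) k) ^ 4 = f - (X 0 ^ 2 * X 1 ^ 2 + X 0 ^ 5 + X 1 ^ 5 + X 2 ^ 5 + X 3 ^ 5) := by rw [hf]; ring
        rw [e]
        refine Ideal.sub_mem _ hfP (Ideal.add_mem _ (Ideal.add_mem _ (Ideal.add_mem _ (Ideal.add_mem _ ?_ ?_) ?_) ?_) ?_)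
        · exact Ideal.mul_mem_left _ _ (Ideal.pow_mem_of_mem _ hy 2 (by norm_num))
        · exact Ideal.pow_mem_of_mem _ hx 5 (by norm_num)
        · exact Ideal.pow_mem_of_mem _ hy 5 (by norm_num)
        · exact Ideal.pow_mem_of_mem _ hu 5 (by norm_num)
        · exact Ideal.pow_mem_of_mem _ ht 5 (by norm_num)
      exact hP'.mem_of_pow_mem 4 hz4
    · exact hall j hj
  obtain ⟨j, hj4, hj⟩ := hex
  exact HypersurfaceRegular.stub_hypersurfaceRegularOfPderiv k 5 f j P
    (by rw [hd j hj4]; exact fun h => hj (hP'.mem_of_pow_mem 4 h))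

/-- The origin is a closed point. [folklore] -/
theorem isClosed_vertex (f : MvPolynomial (Fin 5) k) (hf : f = X 4 ^ 4 + X 0 ^ 2 * X 1 ^ 2 + X 0 ^ 5 + X 1 ^ 5 + X 2 ^ 5 + X 3 ^ 5)
    (v : Spec (.of (MvPolynomial (Fin 5) k ⧸ Ideal.span {f})))
    (hv : v.asIdeal = Ideal.span (Set.range fun j : Fin 5 => Ideal.Quotient.mk (Ideal.span {f}) (X j))) :
    IsClosed ({v} : Set (Spec (.of (MvPolynomial (Fin 5) k ⧸ Ideal.span {f})))) :=
  DoublePointFermatCubicGerm.isClosed_origin k f (constantCoeff_f k f hf) v hv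

/-- The origin is SINGULAR (`f(0) = 0`, `∇f(0) = 0`). [cite: Hartshorne1977, I Thm. 5.1] -/
theorem vertex_not_mem_regularLocus [CharP k 2] (f : MvPolynomial (Fin 5) k) (hf : f = X 4 ^ 4 + X 0 ^ 2 * X 1 ^ 2 + X 0 ^ 5 + X 1 ^ 5 + X 2 ^ 5 + X 3 ^ 5)
    (v : Spec (.of (MvPolynomial (Fin 5) k ⧸ Ideal.span {f})))
    (hv : v.asIdeal = Ideal.span (Set.range fun j : Fin 5 => Ideal.Quotient.mk (Ideal.span {f}) (X j))) :
    v ∉ Scheme.regularLocus (Spec (.of (MvPolynomial (Fin 5) k ⧸ Ideal.span {f}))) := by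
  classical
  obtain ⟨hd, h4⟩ := pderiv_f k f hf
  refine not_mem_regularLocus_Spec_of_not_isRegularLocalRing v ?_
  refine not_isRegularLocalRing_localization_of_pderiv_eval_eq_zero (0 : Fin 5 → k) (prime_f k f hf).ne_zero ?_ ?_ v.asIdeal ?_
  · rw [MvPolynomial.eval_zero]
    exact constantCoeff_f k f hf
  · intro i
    by_cases hi : i = 4
    · subst hi; rw [h4, map_zero]
    · rw [hd i hi]; simp
  · rw [hv, DoublePointFermatCubicGerm.comap_origin k f (constantCoeff_f k f hf), MvPolynomial.eval_zero, Fedder.span_range_X_eq_ker]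

/-- `X` is regular at every point other than the origin (regular-locus form). [cite: Hartshorne1977, I Thm. 5.1] -/
theorem regular_of_ne_vertex [CharP k 2] (f : MvPolynomial (Fin 5) k) (hf : f = X 4 ^ 4 + X 0 ^ 2 * X 1 ^ 2 + X 0 ^ 5 + X 1 ^ 5 + X 2 ^ 5 + X 3 ^ 5)
    (v : Spec (.of (MvPolynomial (Fin 5) k ⧸ Ideal.span {f})))
    (hv : v.asIdeal = Ideal.span (Set.range fun j : Fin 5 => Ideal.Quotient.mk (Ideal.span {f}) (X j))) :
    ∀ y : Spec (.of (MvPolynomial (Fin 5) k ⧸ Ideal.span {f})), y ⤳ v → y ≠ v →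
      y ∈ Scheme.regularLocus (Spec (.of (MvPolynomial (Fin 5) k ⧸ Ideal.span {f}))) := by
  intro y hy hne
  refine FermatCubicConeGerm.mem_regularLocus_Spec_of_isRegularLocalRing y (regular_off_vertex k f hf y.asIdeal fun hle => hne ?_)
  have h2 : y.asIdeal ≤ v.asIdeal := (PrimeSpectrum.le_iff_specializes y v).mpr hy
  exact PrimeSpectrum.ext (le_antisymm h2 (hv ▸ hle))

/-! ## §2 The five point-blow-up charts (`μ = 4`) -/

/-- The chart identities `θ_i f = X_i⁴ · g_i` with res-L1-w45a-idea-1's chart polynomials `g_0 … g_4`. [certificate] -/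
theorem theta (f : MvPolynomial (Fin 5) k) (hf : f = X 4 ^ 4 + X 0 ^ 2 * X 1 ^ 2 + X 0 ^ 5 + X 1 ^ 5 + X 2 ^ 5 + X 3 ^ 5) :
    ∀ i : Fin 5, aeval (fun j : Fin 5 => if j = i then (X i : MvPolynomial (Fin 5) k) else X j * X i) f =
      X i ^ ((fun _ : Fin 5 => 4) i) * (![X 4 ^ 4 + X 1 ^ 2 + X 0 * (1 + X 1 ^ 5 + X 2 ^ 5 + X 3 ^ 5),
        X 4 ^ 4 + X 0 ^ 2 + X 1 * (1 + X 0 ^ 5 + X 2 ^ 5 + X 3 ^ 5),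
        X 4 ^ 4 + X 0 ^ 2 * X 1 ^ 2 + X 2 * (1 + X 0 ^ 5 + X 1 ^ 5 + X 3 ^ 5),
        X 4 ^ 4 + X 0 ^ 2 * X 1 ^ 2 + X 3 * (1 + X 0 ^ 5 + X 1 ^ 5 + X 2 ^ 5),
        1 + X 0 ^ 2 * X 1 ^ 2 + X 4 * (X 0 ^ 5 + X 1 ^ 5 + X 2 ^ 5 + X 3 ^ 5)] : Fin 5 → MvPolynomial (Fin 5) k) i := by
  intro i
  subst hf
  fin_cases i <;> simp <;> ring

/-- `g_i ∉ (X_i)`: `g_i(e_z) = 1` for `i ≠ z`, `g_z(0) = 1`. [certificate] -/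
theorem g_not_mem_span_X :
    ∀ i : Fin 5, (![X 4 ^ 4 + X 1 ^ 2 + X 0 * (1 + X 1 ^ 5 + X 2 ^ 5 + X 3 ^ 5),
        X 4 ^ 4 + X 0 ^ 2 + X 1 * (1 + X 0 ^ 5 + X 2 ^ 5 + X 3 ^ 5),
        X 4 ^ 4 + X 0 ^ 2 * X 1 ^ 2 + X 2 * (1 + X 0 ^ 5 + X 1 ^ 5 + X 3 ^ 5),
        X 4 ^ 4 + X 0 ^ 2 * X 1 ^ 2 + X 3 * (1 + X 0 ^ 5 + X 1 ^ 5 + X 2 ^ 5),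
        1 + X 0 ^ 2 * X 1 ^ 2 + X 4 * (X 0 ^ 5 + X 1 ^ 5 + X 2 ^ 5 + X 3 ^ 5)] : Fin 5 → MvPolynomial (Fin 5) k) i ∉ Ideal.span {(X i : MvPolynomial (Fin 5) k)} := by
  intro i h
  rw [Ideal.mem_span_singleton] at h
  obtain ⟨c, hc⟩ := h
  fin_cases i
  · have := congrArg (MvPolynomial.eval (Pi.single 4 1 : Fin 5 → k)) hc; simp at this
  · have := congrArg (MvPolynomial.eval (Pi.single 4 1 : Fin 5 → k)) hc; simp at this
  · have := congrArg (MvPolynomial.eval (Pi.single 4 1 : Fin 5 → k)) hc; simp at this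
  · have := congrArg (MvPolynomial.eval (Pi.single 4 1 : Fin 5 → k)) hc; simp at this
  · have := congrArg (MvPolynomial.eval (0 : Fin 5 → k)) hc; simp at this

/-! ## §3 ★★ `Bl_𝔪 X` is FULL at every point; the germ's F-half ∃-conclusion -/

/-- ★★ **THE POINT BLOW-UP OF TCa IS FULL AT EVERY POINT** (`char k = 2`, any field): off the origin `X` is regular; over it every closed point of every chart satisfies the clause
by idea-1's derivative certificates (✓ p661452). [OURS · certificate instance; cite: Fedder1983, Thm. 1.12; StacksProject, Tag 0804] -/
theorem tca_pointBlowup_fullCl [CharP k 2] (f : MvPolynomial (Fin 5) k) (hf : f = X 4 ^ 4 + X 0 ^ 2 * X 1 ^ 2 + X 0 ^ 5 + X 1 ^ 5 + X 2 ^ 5 + X 3 ^ 5) :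
    ∀ y : ↥(affineBlowup (Ideal.span (Set.range fun j : Fin 5 => Ideal.Quotient.mk (Ideal.span {f}) (X j)))),
      FullCl 2 ((affineBlowup (Ideal.span (Set.range fun j : Fin 5 => Ideal.Quotient.mk (Ideal.span {f}) (X j)))).presheaf.stalk y) := by
  haveI : Fact (Nat.Prime 2) := ⟨Nat.prime_two⟩
  refine hypersurfacePointBlowup_fullCl 2 k 5 (by norm_num) f _ 4 (isPrime_span_f k f hf) (theta k f hf) (f_not_mem_span_X k f hf) (g_not_mem_span_X k)
    (fun P _ hP => regular_off_vertex k f hf P hP) ?_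
  intro i Q _ _
  fin_cases i
  · exact TCaFloorOneFull.tca_clause_every_chart_every_point k _ (by simp) Q
  · exact TCaFloorOneFull.tca_clause_every_chart_every_point k _ (by simp) Q
  · exact TCaFloorOneFull.tca_clause_every_chart_every_point k _ (by simp) Q
  · exact TCaFloorOneFull.tca_clause_every_chart_every_point k _ (by simp) Q
  · exact TCaFloorOneFull.tca_clause_every_chart_every_point k _ (by simp) Q

/-- ★★ **The F-half's ∃-conclusion at the germ of TCa at the origin, witnessed by the point floor itself**: `FInjectivizationGermAt 2 v`. [OURS · certificate instance] -/
theorem tca_fInjectivizationGermAt [CharP k 2] (f : MvPolynomial (Fin 5) k) (hf : f = X 4 ^ 4 + X 0 ^ 2 * X 1 ^ 2 + X 0 ^ 5 + X 1 ^ 5 + X 2 ^ 5 + X 3 ^ 5)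
    (v : Spec (.of (MvPolynomial (Fin 5) k ⧸ Ideal.span {f})))
    (hv : v.asIdeal = Ideal.span (Set.range fun j : Fin 5 => Ideal.Quotient.mk (Ideal.span {f}) (X j))) :
    FInjectivizationGermAt 2 v := by
  haveI : Fact (Nat.Prime 2) := ⟨Nat.prime_two⟩
  refine fInjectivizationGermAt_origin_of_hypersurfacePointBlowup 2 k 5 (by norm_num) f _ 4 (isPrime_span_f k f hf) (theta k f hf) (f_not_mem_span_X k f hf)
    (g_not_mem_span_X k) (fun P _ hP => regular_off_vertex k f hf P hP) ?_ v hv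
  intro i Q _ _
  fin_cases i
  · exact TCaFloorOneFull.tca_clause_every_chart_every_point k _ (by simp) Q
  · exact TCaFloorOneFull.tca_clause_every_chart_every_point k _ (by simp) Q
  · exact TCaFloorOneFull.tca_clause_every_chart_every_point k _ (by simp) Q
  · exact TCaFloorOneFull.tca_clause_every_chart_every_point k _ (by simp) Q
  · exact TCaFloorOneFull.tca_clause_every_chart_every_point k _ (by simp) Q

/-! ## §4 «legal ∧ FULL» at the germ -/

/-- **The point floor of TCa is a LEGAL INPUT of the F-half** for every blowing up of `Spec 𝒪_{X,v}` along `𝔪̃`: non-zero, supported on the non-regular locus, regular off the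
closed fibre, CM everywhere — ONE application of ✓ p651649 `PointFloorLegalOfIsolated.pointFloor_input_legal`. [folklore assembly] -/
theorem pointFloor_tca_input_legal [CharP k 2] (f : MvPolynomial (Fin 5) k) (hf : f = X 4 ^ 4 + X 0 ^ 2 * X 1 ^ 2 + X 0 ^ 5 + X 1 ^ 5 + X 2 ^ 5 + X 3 ^ 5)
    (v : Spec (.of (MvPolynomial (Fin 5) k ⧸ Ideal.span {f})))
    (hv : v.asIdeal = Ideal.span (Set.range (fun j : Fin 5 => Ideal.Quotient.mk (Ideal.span {f}) (X j))))
    (S' : Scheme.{0}) (g : S' ⟶ Spec ((Spec (.of (MvPolynomial (Fin 5) k ⧸ Ideal.span {f}))).presheaf.stalk v))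
    (hg : IsBlowup g ((affineBlowup.idealSheaf (Ideal.span (Set.range (fun j : Fin 5 => Ideal.Quotient.mk (Ideal.span {f}) (X j))))).comap ((Spec (.of (MvPolynomial (Fin 5) k ⧸ Ideal.span {f}))).fromSpecStalk v))) :
    ((affineBlowup.idealSheaf (Ideal.span (Set.range (fun j : Fin 5 => Ideal.Quotient.mk (Ideal.span {f}) (X j))))).comap ((Spec (.of (MvPolynomial (Fin 5) k ⧸ Ideal.span {f}))).fromSpecStalk v)) ≠ ⊥ ∧
    (((((affineBlowup.idealSheaf (Ideal.span (Set.range (fun j : Fin 5 => Ideal.Quotient.mk (Ideal.span {f}) (X j))))).comap ((Spec (.of (MvPolynomial (Fin 5) k ⧸ Ideal.span {f}))).fromSpecStalk v))).support : Set (Spec ((Spec (.of (MvPolynomial (Fin 5) k ⧸ Ideal.span {f}))).presheaf.stalk v))) ⊆ (Scheme.regularLocus (Spec ((Spec (.of (MvPolynomial (Fin 5) k ⧸ Ideal.span {f}))).presheaf.stalk v)))ᶜ) ∧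
    (∀ s : S', g.base s ≠ closedPoint ((Spec (.of (MvPolynomial (Fin 5) k ⧸ Ideal.span {f}))).presheaf.stalk v) → s ∈ Scheme.regularLocus S') ∧
    (∀ s : S', CMCl (S'.presheaf.stalk s)) :=
  PointFloorLegalOfIsolated.pointFloor_input_legal k f (prime_f k f hf) (by norm_num) (fun _ : Fin 5 => 4) _ (theta k f hf)
    (f_not_mem_span_X k f hf) (g_not_mem_span_X k) v hv (vertex_not_mem_regularLocus k f hf v hv)
    (regular_of_ne_vertex k f hf v hv) S' g hg

/-- ★ **EVERY blowing up of `Spec 𝒪_{X,v}` along `𝔪̃` is FULL at every stalk** (it is the flat pull-back of `Bl_𝔪 X` up to isomorphism, whose stalks are stalks of `Bl_𝔪 X`).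
[folklore transport; cite: GortzWedhorn2020, Prop. 13.91; StacksProject, Tag 0804] -/
theorem pointFloor_tca_full [CharP k 2] (f : MvPolynomial (Fin 5) k) (hf : f = X 4 ^ 4 + X 0 ^ 2 * X 1 ^ 2 + X 0 ^ 5 + X 1 ^ 5 + X 2 ^ 5 + X 3 ^ 5)
    (v : Spec (.of (MvPolynomial (Fin 5) k ⧸ Ideal.span {f})))
    (S' : Scheme.{0}) (g : S' ⟶ Spec ((Spec (.of (MvPolynomial (Fin 5) k ⧸ Ideal.span {f}))).presheaf.stalk v))
    (hg : IsBlowup g ((affineBlowup.idealSheaf (Ideal.span (Set.range (fun j : Fin 5 => Ideal.Quotient.mk (Ideal.span {f}) (X j))))).comap ((Spec (.of (MvPolynomial (Fin 5) k ⧸ Ideal.span {f}))).fromSpecStalk v))) :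
    ∀ s : S', FullCl 2 (S'.presheaf.stalk s) := by
  haveI : Flat ((Spec (.of (MvPolynomial (Fin 5) k ⧸ Ideal.span {f}))).fromSpecStalk v) := flat_fromSpecStalk _ v
  have hP := (affineBlowup.isBlowup (Ideal.span (Set.range (fun j : Fin 5 => Ideal.Quotient.mk (Ideal.span {f}) (X j))))).pullback_snd_of_flat
    ((Spec (.of (MvPolynomial (Fin 5) k ⧸ Ideal.span {f}))).fromSpecStalk v)
  obtain ⟨e, -, -⟩ := hg.unique hP
  intro s
  haveI := isIso_stalkMap_of_flat_of_isPreimmersion e.hom s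
  refine FTemkinClosedPoints.fullCl_of_isIso_stalkMap' 2 e.hom s ?_
  haveI := isIso_stalkMap_pullback_fst_fromSpecStalk
    (affineBlowup.π (Ideal.span (Set.range (fun j : Fin 5 => Ideal.Quotient.mk (Ideal.span {f}) (X j))))) v (e.hom s)
  exact FTemkinClosedPoints.fullCl_of_isIso_stalkMap' 2
    (pullback.fst (affineBlowup.π (Ideal.span (Set.range (fun j : Fin 5 => Ideal.Quotient.mk (Ideal.span {f}) (X j))))) ((Spec (.of (MvPolynomial (Fin 5) k ⧸ Ideal.span {f}))).fromSpecStalk v))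
    (e.hom s) (tca_pointBlowup_fullCl k f hf _)

end Summit.ResolutionOfSingularities.ResolutionOfSingularities.Theorems.FInjectiveMacaulayfication.TCaFloorOneRow

end
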